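import Summits.BirchSwinnertonDyer.Rank1Residual.X2.ResidualDevissageLine
import Literature.NumberTheory.EllipticCurves.Rank1Residual.GVParityIsogenyConjugationProofs
import HarnessLib

/-!
# GV CASE 2 ⟹ CASE 1 along the quotient isogeny at `p ‖ N`: the image of an unramified-odd kernel
# line is a RAMIFIED-EVEN rational line (cell `b2b-bsdres`, unit `b2b-bsdres-eisenstein-p2`, gen 18)

HONEST FRAMING (run/shared/lean/b2b/bsd-rank1-residual/, verbatim in every file): the goal of the
cell is to DELETE the COMBINATION-SHAPED residual classes of the Birch–Swinnerton-Dyer formula for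
ALL analytic-rank `≤ 1` elliptic curves over `ℚ` — "full BSD formula for every rank `≤ 1` curve in
class `C`" assembled STRICTLY from published theorems — so that the rank-`≤ 1` remainder becomes
exactly the CONSTRUCTION-SHAPED classes, which are TYPED (missing-input `Prop`s), NOT attempted.
This is not "finishing BSD". Research route; NO CLAIM BEYOND STATED CLASSES; nothing here changes
a label. Theorems only; no definition, no named fact.

WHY (X2-GAP §22.6 (iii): GV CASE 2). The Greenberg–Vatsal parity hypothesis `GVPar W p` has two
cases: a rational line `Φ₀ ≤ E[p]` which is (1) ramified at `p` and even, or (2) unramified at `p`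
and odd. Gens 16–17 derived the `λ/μ` clause of the flag `GV00-mult-asserted` in CASE 1 (modulo two
typed printed inputs). GV p. 28 reduce CASE 2 to CASE 1 by the `p`-isogeny `E → E' = E/Φ₀`: the
image line `E[p]/Φ₀ ⊂ E'[p]` has the complementary character `ψ = ωφ⁻¹`, ramified at `p` and even.
This file proves that step at a MULTIPLICATIVE prime `p ‖ N` (`p` odd), where the local input is
the TATE LINE `C[p] ≅ μ_p` (inertia acts on `E[p]` through `(ω *; 0 1)`):

* §1 `isRationalLine_range_and_ramified_even_of_ker` — pure Galois modules: for an equivariant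
  `g : E[p] → E'[p]` with kernel a line `K` UNRAMIFIED at `p` and ODD, the image `g(E[p])` is a
  rational line RAMIFIED at `p` and EVEN, granted (hL₀) a line `L ≤ E[p]` at ONE prime `𝔓 ∣ p` with
  `(σ − 1)E[p] ⊆ L` for `σ ∈ I_𝔓` and a point of `L` moved by `I_𝔓`, and (hc) the two signs of
  complex conjugation (x1a's `gvPar_of_ker_line` argument, which only recorded `GVPar W' p`);
* §2 `exists_tateLine_adicCompletionPrime` — (hL₀) at an odd `p ‖ N` from gens 9/13's Tate data
  (`exists_data_of_split` / `exists_data_of_not_split`: `I_p` trivial on `E[p^∞]/C`, `I_p` moves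
  `C[p]`, `#C[p] = p`), read at `𝔓₀ = adicCompletionPrime ℚ v` through Neukirch II (9.6)
  (`inertia_adicCompletionPrime_eq_map_absInertia`); inputs: the Tate uniformisation named facts
  A40/A41 (`hT`, `hT'`), as everywhere in the X2 kernel;
* §3 `exists_rationalLine_ramified_even_of_isogeny` — for `E/ℚ` globally minimal, `p ≠ 2`
  multiplicative, `Φ₀` a rational line unramified at `p` and odd, and a `ℚ`-isogeny `g : E → E'`
  with `ker g = Φ₀`: `E'` has a rational line RAMIFIED at `p` and EVEN ((hc) by the Weil pairing,
  `exists_fixed_and_antifixed_of_isComplexConjugation`).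

References: [GreenbergVatsal2000] §2 p. 28, pp. 14–15; [SerreInventiones1972] §1.11;
[SilvermanATAEC1994] V.5.3, V.5.4; HOME/b2b-bsdres-eisenstein-p2/X2-GAP.md §23.
-/

set_option autoImplicit false

noncomputable section

open scoped Classical AddSubgroup

open WeierstrassCurve Literature.NumberTheory.EllipticCurves Literature.NumberTheory.GaloisRepresentations
  Field IsDedekindDomain NumberField
  Literature.NumberTheory.EllipticCurves.GreenbergSelmer
  Literature.NumberTheory.EllipticCurves.Rank1Residual
  Summit.BirchSwinnertonDyer.Rank1Residual.X2.GreenbergVatsalTorsion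
  Summit.BirchSwinnertonDyer.Rank1Residual.X2.GreenbergVatsalTateDatumCofree

namespace Summit.BirchSwinnertonDyer.Rank1Residual.X2.IsogenyLineType

variable {W W' : WeierstrassCurve ℚ} {p : ℕ} [hp : Fact p.Prime]

/-! ## §1. Galois modules: the image of an unramified-odd kernel line is a ramified-even line -/

section KernelLine

variable (g : geomTorsion W (p : ℤ) →+ geomTorsion W' (p : ℤ))
  (hg : ∀ (σ : absoluteGaloisGroup ℚ) (P : geomTorsion W (p : ℤ)), g (σ • P) = σ • g P)

include hg in
/-- **The image of an unramified-odd kernel line is a ramified-even rational line.** Let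
`g : E[p] → E'[p]` be `Γ_ℚ`-equivariant with kernel `K` of order `p` (`#E[p] = p²`, `p` odd), and
assume: (hL₀) at SOME prime `𝔓` of `\bar ℤ` above `p` there is a line `L ≤ E[p]` with
`(σ - 1)E[p] ⊆ L` for all `σ ∈ I_𝔓` and some `σ ∈ I_𝔓` moving a point of `L` (at `p ‖ N`: the Tate
line, §2); (hc) every complex conjugation has a non-zero fixed and a non-zero anti-fixed point on
`E[p]`. If `K` is unramified at `p` and odd, then `g(E[p]) ≅ E[p]/K` is a rational line of `E'[p]`
which is RAMIFIED at `p` and EVEN — Greenberg–Vatsal's reduction of the case "`φ` unramified and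
odd" to the case "`φ` ramified and even" (p. 28: `E' = E/Φ`). The argument is the one of x1a's
`gvPar_of_ker_line` (which only records `GVPar W' p`), with (hL) needed at one prime only.
[cite: GreenbergVatsal2000, §2 p. 28 (reduction to φ ramified and even)] -/
theorem isRationalLine_range_and_ramified_even_of_ker (hp2 : p ≠ 2)
    (hE : Nat.card (geomTorsion W (p : ℤ)) = p ^ 2)
    (hL₀ : ∃ (v : HeightOneSpectrum (𝓞 ℚ)), (p : 𝓞 ℚ) ∈ v.asIdeal ∧ ∃ 𝔓 ∈ v.primesAbove,
      ∃ L : AddSubgroup (geomTorsion W (p : ℤ)), Nat.card L = p ∧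
        (∀ σ ∈ 𝔓.inertia (absoluteGaloisGroup ℚ), ∀ P : geomTorsion W (p : ℤ), σ • P - P ∈ L) ∧
        (∃ σ ∈ 𝔓.inertia (absoluteGaloisGroup ℚ), ∃ P ∈ L, σ • P ≠ P))
    (hc : ∀ c : absoluteGaloisGroup ℚ, IsComplexConjugation (Rat.castHom ℝ) c →
      (∃ P : geomTorsion W (p : ℤ), P ≠ 0 ∧ c • P = P) ∧
        (∃ Q : geomTorsion W (p : ℤ), Q ≠ 0 ∧ c • Q = -Q))
    (hK : Nat.card g.ker = p) (hu : LineUnramifiedAt W p g.ker) (ho : LineOdd W p g.ker) :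
    IsRationalLine W' p g.range ∧ ¬ LineUnramifiedAt W' p g.range ∧ LineEven W' p g.range := by
  have hΨ : IsRationalLine W' p g.range := isRationalLine_range g hg hE hK
  -- complex conjugation acts on the line `g(E[p])` by `+1` or by `-1`
  have hsign : ∀ c : absoluteGaloisGroup ℚ, IsComplexConjugation (Rat.castHom ℝ) c →
      (∀ y ∈ g.range, c • y = y) ∨ (∀ y ∈ g.range, c • y = -y) :=
    fun c hcc ↦ smul_eq_self_or_eq_neg_of_sq_eq_one hΨ hcc.sq_eq_one
  have hcc2 : ∀ c : absoluteGaloisGroup ℚ, IsComplexConjugation (Rat.castHom ℝ) c →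
      ∀ P : geomTorsion W (p : ℤ), c • c • P = P := by
    intro c hcc P
    rw [← mul_smul, ← pow_two, hcc.sq_eq_one, one_smul]
  refine ⟨hΨ, ?_, ?_⟩
  · -- ramified: the Tate line `L` at `𝔓` is not `K` (`K` unramified, `L` has a moved point), so
    -- `K ⊓ L = ⊥`, and `σ₀` moves `g x₀`
    intro hunr
    obtain ⟨v, hv, 𝔓, h𝔓, L, hLcard, hLsub, σ₀, hσ₀, x₀, hx₀, hne⟩ := hL₀
    have hKL : g.ker ⊓ L = ⊥ := by
      rcases line_eq_or_inf_eq_bot hK hLcard with h | h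
      · exact absurd (hu v hv 𝔓 h𝔓 σ₀ hσ₀ x₀ (h ▸ hx₀)) hne
      · exact h
    have hy : g x₀ ∈ g.range := AddMonoidHom.mem_range.mpr ⟨x₀, rfl⟩
    have h1 : σ₀ • g x₀ = g x₀ := hunr v hv 𝔓 h𝔓 σ₀ hσ₀ _ hy
    have h2 : σ₀ • x₀ - x₀ ∈ g.ker := by
      rw [AddMonoidHom.mem_ker, map_sub, hg, h1, sub_self]
    have h3 : σ₀ • x₀ - x₀ ∈ g.ker ⊓ L := AddSubgroup.mem_inf.mpr ⟨h2, hLsub σ₀ hσ₀ x₀⟩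
    rw [hKL, AddSubgroup.mem_bot, sub_eq_zero] at h3
    exact hne h3
  · -- even: `c = -1` on `g(E[p])` and on `K` would force `c = -1` on `E[p]`, against (hc)
    intro c hcc y hy
    rcases hsign c hcc with hplus | hminus
    · exact hplus y hy
    · exfalso
      obtain ⟨⟨P₀, hP₀0, hP₀⟩, -⟩ := hc c hcc
      have hall : ∀ P : geomTorsion W (p : ℤ), c • P = -P := by
        intro P
        have h1 : c • g P = -g P := hminus (g P) (AddMonoidHom.mem_range.mpr ⟨P, rfl⟩)
        have h2 : c • P + P ∈ g.ker := by
          rw [AddMonoidHom.mem_ker, map_add, hg, h1, neg_add_cancel]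
        have h3 : c • (c • P + P) = -(c • P + P) := ho c hcc _ h2
        rw [smul_add, hcc2 c hcc P] at h3
        have h4 : (c • P + P) + (c • P + P) = 0 := by
          have hx : c • P + P = -(c • P + P) :=
            calc c • P + P = P + c • P := add_comm _ _
              _ = -(c • P + P) := h3
          nth_rewrite 2 [hx]
          exact add_neg_cancel _
        have h5 : c • P + P = 0 := eq_zero_of_add_self_eq_zero hp2 h4
        exact eq_neg_of_add_eq_zero_left h5
      have : P₀ + P₀ = 0 := by
        have hq := hall P₀
        rw [hP₀] at hq
        nth_rewrite 2 [hq]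
        exact add_neg_cancel P₀
      exact hP₀0 (eq_zero_of_add_self_eq_zero hp2 this)

end KernelLine

/-! ## §2. The Tate line at an odd `p ‖ N`, in `𝔓.inertia` form (hL₀) -/

section TateLine

variable (W p) [W.IsElliptic] [W.IsGloballyMinimal]

omit [W.IsElliptic] [W.IsGloballyMinimal] in
/-- From a Greenberg datum `N` on `E[p^∞]` above `v ∣ p` with inertially trivial graded piece
(`htriv`), inertially generated residual line (`hgen`) and `#(N⁺ ∩ E[p^∞][p]) = p` (`hC`): the
line `X₀ = N⁺ ∩ E[p] ≤ E[p]` has order `p`, `(σ - 1)E[p] ⊆ X₀` for every `σ` in the inertia group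
of `𝔓₀ = adicCompletionPrime ℚ v` (Neukirch II (9.6), tree
`inertia_adicCompletionPrime_eq_map_absInertia`), and some such `σ` moves a point of `X₀`.
[cite: GreenbergVatsal2000, §2 pp. 14–15 and p. 26] -/
theorem exists_line_adicCompletionPrime_of_datum {v : HeightOneSpectrum (𝓞 ℚ)}
    (hv : ((p : ℕ) : 𝓞 ℚ) ∈ v.asIdeal) (N : LocalDatum ℚ (W.geomPrimaryTorsion p) v)
    (htriv : ∀ x ∈ inertia v, ∀ m : W.geomPrimaryTorsion p, x • m - m ∈ N.plus)
    (hgen : ∀ c ∈ (torsionDatum N p).plus, ∃ τ ∈ inertia v,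
      ∃ c' ∈ (torsionDatum N p).plus, τ • c' - c' = c)
    (hC : Nat.card ↥(N.plus ⊓ (↥(W.geomPrimaryTorsion p))[(p : ℤ)]) = p) :
    ∃ L : AddSubgroup (geomTorsion W (p : ℤ)), Nat.card L = p ∧
      (∀ σ ∈ (adicCompletionPrime ℚ v).inertia (absoluteGaloisGroup ℚ),
        ∀ P : geomTorsion W (p : ℤ), σ • P - P ∈ L) ∧
      (∃ σ ∈ (adicCompletionPrime ℚ v).inertia (absoluteGaloisGroup ℚ), ∃ P ∈ L, σ • P ≠ P) := by
  have _ := hv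
  set X : AddSubgroup (geomTorsion W (p : ℤ)) :=
    N.plus.comap (AddSubgroup.inclusion (geomTorsion_le_geomPrimaryTorsion W p)) with hX
  have hXcard : Nat.card X = p := by
    rw [hX, TateLineDecomposition.natCard_comap_eq W p N, hC]
  refine ⟨X, hXcard, ?_, ?_⟩
  · intro σ hσ P
    rw [inertia_adicCompletionPrime_eq_map_absInertia] at hσ
    rw [hX, TateLineDecomposition.mem_comap_iff, map_sub, TateLineDecomposition.inclusion_smul]
    exact htriv σ hσ _
  · -- a non-zero point of `X` (order `p > 1`), moved by some inertia element (`hgen`)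
    haveI : Finite X := Nat.finite_of_card_ne_zero (by rw [hXcard]; exact hp.out.ne_zero)
    have h1 : 1 < Nat.card X := by rw [hXcard]; exact hp.out.one_lt
    obtain ⟨P, hPX, hP0⟩ : ∃ P ∈ X, P ≠ 0 := by
      by_contra h
      push Not at h
      have : Nat.card X = 1 := by
        rw [Nat.card_eq_one_iff_exists]
        exact ⟨⟨0, X.zero_mem⟩, fun ⟨Q, hQ⟩ ↦ Subtype.ext (h Q hQ)⟩
      omega
    obtain ⟨τ, hτ, Q, hQ, hne⟩ :=
      TateLineDecomposition.exists_mem_inertia_smul_ne_of_hgen W p N hgen hPX hP0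
    refine ⟨τ, ?_, Q, hQ, hne⟩
    rw [inertia_adicCompletionPrime_eq_map_absInertia]
    exact hτ

/-- **(hL₀) at an odd multiplicative prime** (the TATE LINE): for `E/ℚ` globally minimal with
multiplicative reduction at the odd prime `p`, at the place `v` of `ℚ` above `p` and the prime
`𝔓₀ = adicCompletionPrime ℚ v` of `\bar ℤ` there is a line `L ≤ E[p]` (`L = C[p]`, `C` the Tate
line `Φ(μ_{p^∞})`) of order `p` with `(σ - 1)E[p] ⊆ L` for all `σ ∈ I_{𝔓₀}` and some `σ ∈ I_{𝔓₀}`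
moving a point of `L` (the cyclotomic character is onto `ℤ_pˣ` on inertia). Inputs: the Tate
uniformisation named facts (*ATAEC* V.5.3 / Cor. V.5.4: `hT`, `hT'`) through gens 9/13's Tate data
(`exists_data_of_split` / `exists_data_of_not_split`: `htriv`, `hgen`, `#(C ∩ E[p^∞][p]) = p`).
[cite: SilvermanATAEC1994, Thm. V.5.3 and Cor. V.5.4] [cite: GreenbergVatsal2000, §2 pp. 14–15] -/
theorem exists_tateLine_adicCompletionPrime
    (hT : Silverman1994_thmV53_tateUniformisation.{0})
    (hT' : Silverman1994_thmV53_corV54_tateUniformisation.{0})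
    (hp2 : p ≠ 2) (hmult : W.HasMultiplicativeReductionAtPrime p) :
    ∃ (v : HeightOneSpectrum (𝓞 ℚ)), (p : 𝓞 ℚ) ∈ v.asIdeal ∧ ∃ 𝔓 ∈ v.primesAbove,
      ∃ L : AddSubgroup (geomTorsion W (p : ℤ)), Nat.card L = p ∧
        (∀ σ ∈ 𝔓.inertia (absoluteGaloisGroup ℚ), ∀ P : geomTorsion W (p : ℤ), σ • P - P ∈ L) ∧
        (∃ σ ∈ 𝔓.inertia (absoluteGaloisGroup ℚ), ∃ P ∈ L, σ • P ≠ P) := by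
  have hpP : p.Prime := hp.out
  obtain ⟨v, hv⟩ :=
    Literature.NumberTheory.NumberFields.RingOfIntegers.exists_heightOneSpectrum_natCast_mem ℚ hpP
  refine ⟨v, hv, adicCompletionPrime ℚ v, adicCompletionPrime_mem_primesAbove ℚ v, ?_⟩
  obtain ⟨κ, hκ, -⟩ := exists_isCyclotomic_isTopGenerator_isCyclotomicVariable_holds p
  by_cases hsplit : W.HasSplitMultiplicativeReductionAtPrime p
  · obtain ⟨L, htriv, hgen, hC, -⟩ := exists_data_of_split W p κ hT hp2 hsplit
    exact exists_line_adicCompletionPrime_of_datum W p hv (L v hv) (htriv v hv) (hgen v hv)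
      (hC v hv).2
  · obtain ⟨L, htriv, hgen, hC, -⟩ := exists_data_of_not_split W p κ hT' hκ hp2 hmult hsplit
    exact exists_line_adicCompletionPrime_of_datum W p hv (L v hv) (htriv v hv) (hgen v hv)
      (hC v hv).2

end TateLine

/-! ## §3. Assembly: CASE 2 for `E` gives CASE 1 for `E/Φ₀` -/

section Assembly

variable [W.IsElliptic] [W.IsGloballyMinimal]

omit hp [W.IsElliptic] [W.IsGloballyMinimal] in
/-- The restriction of a `ℚ`-isogeny to the `p`-torsion, `g : E[p] →+ E'[p]` (values and
equivariance). [folklore] -/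
theorem exists_restrict_torsion (f : Isogeny W W') :
    ∃ g : geomTorsion W (p : ℤ) →+ geomTorsion W' (p : ℤ),
      (∀ P : geomTorsion W (p : ℤ), (g P : geomPoints W') = f (P : geomPoints W)) ∧
      (∀ (σ : absoluteGaloisGroup ℚ) (P : geomTorsion W (p : ℤ)), g (σ • P) = σ • g P) := by
  have hmem : ∀ P : geomTorsion W (p : ℤ), f (P : geomPoints W) ∈ geomTorsion W' (p : ℤ) := by
    intro P
    have h0 : (p : ℤ) • (P : geomPoints W) = 0 := (Submodule.mem_torsionBy_iff (p : ℤ) _).mp P.2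
    have h1 : (p : ℤ) • f (P : geomPoints W) = 0 := by rw [← map_zsmul, h0, map_zero]
    exact (Submodule.mem_torsionBy_iff (p : ℤ) _).mpr h1
  let g : geomTorsion W (p : ℤ) →+ geomTorsion W' (p : ℤ) :=
    { toFun := fun P ↦ ⟨f (P : geomPoints W), hmem P⟩
      map_zero' := Subtype.ext (by simp)
      map_add' := fun P Q ↦ Subtype.ext (by simp) }
  have hgval : ∀ P : geomTorsion W (p : ℤ), (g P : geomPoints W') = f (P : geomPoints W) :=
    fun _ ↦ rfl
  refine ⟨g, hgval, fun σ P ↦ ?_⟩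
  apply Subtype.ext
  rw [hgval, AddSubgroup.torsionBy.coe_smul, AddSubgroup.torsionBy.coe_smul, hgval, f.map_smul]

/-- **GV CASE 2 for `E` ⟹ CASE 1 for `E' = E/Φ₀`.** Let `E/ℚ` be globally minimal with
multiplicative reduction at the odd prime `p`, `Φ₀ ≤ E[p]` a rational line UNRAMIFIED at `p` and
ODD, and `g : E → E'` a `ℚ`-isogeny whose kernel on `ℚ̄`-points is `Φ₀`. Then `E'[p]` contains a
rational line (namely `g(E[p]) ≅ E[p]/Φ₀`) which is RAMIFIED at `p` and EVEN — granted the Tate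
uniformisation facts `hT`, `hT'` (for the Tate line of §2); the signs of complex conjugation come
from the Weil pairing (`exists_fixed_and_antifixed_of_isComplexConjugation`). GV p. 28.
[cite: GreenbergVatsal2000, §2 p. 28 (reduction to φ ramified and even)] -/
theorem exists_rationalLine_ramified_even_of_isogeny
    (hT : Silverman1994_thmV53_tateUniformisation.{0})
    (hT' : Silverman1994_thmV53_corV54_tateUniformisation.{0})
    (hp2 : p ≠ 2) (hmult : W.HasMultiplicativeReductionAtPrime p)
    {Φ₀ : AddSubgroup (geomTorsion W (p : ℤ))} (hΦ : IsRationalLine W p Φ₀)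
    (hu : LineUnramifiedAt W p Φ₀) (ho : LineOdd W p Φ₀)
    (f : Isogeny W W') (hker : f.toAddMonoidHom.ker = Φ₀.map (geomTorsion W (p : ℤ)).subtype) :
    ∃ Φ' : AddSubgroup (geomTorsion W' (p : ℤ)),
      IsRationalLine W' p Φ' ∧ ¬ LineUnramifiedAt W' p Φ' ∧ LineEven W' p Φ' := by
  obtain ⟨g, hgval, hg⟩ := exists_restrict_torsion (p := p) f
  -- `ker g = Φ₀`
  have hK : g.ker = Φ₀ := by
    ext P
    rw [AddMonoidHom.mem_ker]
    constructor
    · intro hP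
      have h1 : (P : geomPoints W) ∈ f.toAddMonoidHom.ker := by
        rw [AddMonoidHom.mem_ker, Isogeny.coe_toAddMonoidHom, ← hgval, hP]; rfl
      rw [hker] at h1
      obtain ⟨Q, hQ, hQP⟩ := h1
      have : Q = P := Subtype.ext hQP
      exact this ▸ hQ
    · intro hP
      have h1 : (P : geomPoints W) ∈ f.toAddMonoidHom.ker := by
        rw [hker]; exact ⟨P, hP, rfl⟩
      rw [AddMonoidHom.mem_ker, Isogeny.coe_toAddMonoidHom, ← hgval] at h1
      exact Subtype.ext h1
  have hKcard : Nat.card g.ker = p := by rw [hK]; exact hΦ.1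
  obtain ⟨hline, hram, heven⟩ := isRationalLine_range_and_ramified_even_of_ker g hg hp2
    (Rank1Residual.natCard_geomTorsion W p) (exists_tateLine_adicCompletionPrime W p hT hT' hp2 hmult)
    (exists_fixed_and_antifixed_of_isComplexConjugation W hp2) hKcard (hK ▸ hu) (hK ▸ ho)
  exact ⟨g.range, hline, hram, heven⟩

end Assembly

end Summit.BirchSwinnertonDyer.Rank1Residual.X2.IsogenyLineType

end
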